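import Summits.QuantumFields.BalabanUV.T4Continuum.Support.LineAveragingPairing
import Summits.QuantumFields.BalabanUV.T4Continuum.Support.ScalarBlockPlanting
import Summits.QuantumFields.BalabanUV.Beta.GAN24.DirichletBoxRegularity

/-!
# T⁴ programme, spine node NE2 (U1a), sub-row Δ1 «NE2⁰-Dirichlet» — owner item O15-a, leaves (B)+(Bᵗ) «GAUGE-COLUMNS-TWO-LEVEL»,
# file B1: THE CELLWISE TAYLOR PLANTING of coarse scalars, whose fine gradient IS King's planted coarse gradient inside every cell
# and differs on the face-crossing bonds by MIXED second differences (torus lattice calculus)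

NE2 formalisation swarm `b2b-balaban-t4-ne2-formalise-*`, LEAF PROVER 05 (gen 9); owner rulings R35 (c) / R36 (a) (journal
`CLAIMS.log` 2026-08-20 l.22128 / l.22328: «(B)+(Bᵗ) → leaf-05-g9 NOW, GO; B1 `CellTaylorPlanting` INTENT GO»).  Leaf (B) of the owner's
`RegionGaugeResolventTower.hinjK_of_local` (p238533) asks for `‖B̂_{k+1} − JpR·B̂_k‖ ≤ Cb·θ^k`, `B̂ = √(n^d)·∂_Ω G′_Ω Q′_Ωᴴ`: the fine
GRADIENT FIELD of the scalar box solution with block data against the PLANTED coarse gradient field.  The route of record (EST §G15.0 (B);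
this seat's l.22313 (i)–(iv)) compares both with the fine gradient of a CELLWISE TAYLOR planting `T ψ` of the coarse solution `ψ`, then
uses the energy trick `‖∂′(ψ′ − Tψ)‖² ≤ ‖ψ′ − Tψ‖·‖D′(Tψ) − D′ψ′‖` (file B3).  THIS FILE is the torus lattice calculus of `T` (two levels
`N`, `R·N`; King's cells `par`/`rem` of `BalabanAveragedTowerModes`; scalar planting `JK0` of `ScalarBlockPlanting`, 1-form planting `JK`):

 * §1 `tw x μ = rem(x)_μ / R` (in-cell Taylor weights, `‖tw‖ ≤ 1`), `cJ = √(R^d)·R^{−d}` (King's constant), the offsets under `+e_ν`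
   (`rem_add_unitVec_of_ne`, `val_rem_add_unitVec_of_face/_of_not_face`, `val_rem_of_face`);
 * §2 **`taylorJ N R M`**: `(Tψ)(x) = cJ·[ψ(par x) + Σ_μ tw_μ(x)·(ψ(par x + e_μ) − ψ(par x))]` (`taylorJ_mulVec`), `JK0_mulVec`, and
   **`norm_sq_mul_nsq_taylorJ_sub_JK0_le`**: `‖c‖²·nsq (Tψ − J₀ψ) ≤ d·nsq (∂_c ψ)` (the Taylor correction costs one coarse gradient);
 * §3 THE GRADIENT IDENTITY **`GradOp_taylorJ_sub_JK_GradOp_apply`**: on the fine bond `(x, ν)`,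
   `(∂′_{R·c}(Tψ) − JK(∂_c ψ))(x,ν) = [R ∣ x_ν + 1]·cJ·R·c·Σ_{μ≠ν} tw_μ(x)·Δ²_{νμ}ψ(par x)`,
   `Δ²_{νμ}ψ(X) = ψ(X+e_ν+e_μ) − ψ(X+e_ν) − ψ(X+e_μ) + ψ(X)` — ZERO on every intra-cell bond, mixed second differences on the
   face-crossing bonds; and the norm form **`norm_sq_mul_nsq_GradOp_taylorJ_sub_le`**:
   `‖c‖²·nsq (∂′_{R·c}(Tψ) − JK(∂_c ψ)) ≤ d·R²·Hmixed c ψ` with gan24's `DirichletBoxRegularity.Hmixed c ψ = Σ_μ Σ_{ν≠μ} ‖∂_μ∂_νψ‖²`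
   (for the zero-extension of a box solution, `Hmixed ≤ Σ_{Ω}|Δψ|²` by `sum_normSq_LapS_eq` — corner-free H², constant 1).

HONEST FRAMING (T4-DAG p. 1).  [folklore] lattice calculus on a finite torus, statements and constants OURS; `U = 1`; when consumed: ONE
region, ONE averaging scale, model level; (B), (Bᵗ) NOT proved here (files B2–B4); `hinjK` / W3 on boxes OPEN; NE2 (U1a) NOT proved; spine
PROVED 0/9 unchanged; NOT [B9] (3.23)–(3.27) as printed; NOT infinite volume / mass gap / Clay.  HONEST DEPENDENCY: continuum YM on T⁴ ⇐
BetaPertH ∧ nine spine estimates (0/9 proved); BetaPertH ⇐ (D1) ∧ (D4) ∧ CAP+tail; G-an2-4 gates asym, D1 and NE2/3/4.  No `sorry`.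
-/

noncomputable section

open scoped BigOperators ComplexConjugate Matrix
open Finset

namespace Summit.QuantumFields.BalabanUV.T4Continuum.CellTaylorPlanting

open Literature.MathematicalPhysics.QuantumFieldTheory.Balaban1983to89.B5Prop11Plancherel (Tor fine unitVec)
open Literature.MathematicalPhysics.QuantumFieldTheory.Balaban1983to89.B5Prop11Lower (nsq nsq_nonneg)
open Literature.MathematicalPhysics.QuantumFieldTheory.Balaban1983to89.B5Action121 (sdiff shiftS GradOp GradOp_mulVec sdiff_mulVec)
open Summit.QuantumFields.BalabanUV.T4Continuum
open Literature.MathematicalPhysics.QuantumFieldTheory.Balaban1983to89.B5G183RateTorus (cpt)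
open Literature.MathematicalPhysics.QuantumFieldTheory.Balaban1983to89.B5G183RateTorusW (off)
open Summit.QuantumFields.BalabanUV.T4Continuum.BalabanAveragedTowerModes (par rem par_cpt_add_off rem_cpt_add_off)
open Summit.QuantumFields.BalabanUV.T4Continuum.BalabanBlockPoincare (tileEquiv)
open Summit.QuantumFields.BalabanUV.T4Continuum.KingPairingPlantedLaw (JK)
open Summit.QuantumFields.BalabanUV.T4Continuum.BlockPairingGeometry (parT par_add_unitVec)
open Summit.QuantumFields.BalabanUV.T4Continuum.LineAveragingPairing (JK_mulVec)
open Summit.QuantumFields.BalabanUV.T4Continuum.ScalarBlockPlanting (Qavg0 JK0 star_Qavg0_apply)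
open Summit.QuantumFields.BalabanUV.Beta.GAN24.DirichletBoxRegularity (Hmixed)

variable {d : ℕ} (N R : ℕ) [NeZero N] [NeZero R] (M : Fin d → ℕ) [hM : ∀ μ, NeZero (M μ)]

/-! ## §1 Weights, King's constant, offsets under a unit step -/

/-- the in-cell Taylor weight `tw_μ(x) = rem(x)_μ / R ∈ [0, 1)`. [folklore] -/
def tw (x : Tor (fine (R * N) M)) (μ : Fin d) : ℂ := ((rem N R M x μ : ℕ) : ℂ) / (R : ℂ)

/-- King's planting constant `cJ = √(R^d)·R^{−d} = R^{−d/2}`. [cite: King1986, p.664 (convention before Prop. 3.8)] [folklore] -/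
def cJ (d R : ℕ) : ℂ := (((Real.sqrt ((R : ℝ) ^ d)) : ℝ) : ℂ) * ((R : ℂ) ^ d)⁻¹

omit [NeZero N] hM in
/-- `‖tw_μ(x)‖ ≤ 1`. [folklore] -/
theorem norm_tw_le_one (x : Tor (fine (R * N) M)) (μ : Fin d) : ‖tw N R M x μ‖ ≤ 1 := by
  have hR : (0 : ℝ) < R := Nat.cast_pos.mpr (Nat.pos_of_ne_zero (NeZero.ne R))
  unfold tw
  rw [norm_div, Complex.norm_natCast, Complex.norm_natCast, div_le_one hR]
  exact_mod_cast (rem N R M x μ).isLt.le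

/-- `‖cJ‖²·R^d = 1`. [folklore] -/
theorem norm_cJ_sq_mul : ‖cJ d R‖ ^ 2 * (R : ℝ) ^ d = 1 := by
  have hR : (0 : ℝ) < (R : ℝ) ^ d := pow_pos (Nat.cast_pos.mpr (Nat.pos_of_ne_zero (NeZero.ne R))) d
  unfold cJ
  rw [norm_mul, norm_inv, norm_pow, Complex.norm_natCast, Complex.norm_real, Real.norm_of_nonneg (Real.sqrt_nonneg _), mul_pow,
    Real.sq_sqrt hR.le, inv_pow]
  field_simp

omit [NeZero N] hM in
/-- the other offsets are untouched by a step in direction `ν`. [folklore] -/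
theorem rem_add_unitVec_of_ne {μ ν : Fin d} (h : μ ≠ ν) (x : Tor (fine (R * N) M)) :
    rem N R M (x + unitVec (fine (R * N) M) ν) μ = rem N R M x μ := by
  apply Fin.ext
  simp [rem, unitVec, h]

omit [NeZero N] hM in
/-- on the far `ν`-face the own offset is `R − 1`. [folklore] -/
theorem val_rem_of_face {ν : Fin d} {x : Tor (fine (R * N) M)} (hf : R ∣ (x ν).val + 1) : (rem N R M x ν : ℕ) = R - 1 := by
  have hR : 0 < R := Nat.pos_of_ne_zero (NeZero.ne R)
  show (x ν).val % R = R - 1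
  obtain ⟨q, hq⟩ := hf
  have hq0 : 0 < q := by
    rcases Nat.eq_zero_or_pos q with h | h
    · rw [h, mul_zero] at hq; omega
    · exact h
  have e : (x ν).val = R * (q - 1) + (R - 1) := by
    obtain ⟨q', rfl⟩ : ∃ q', q = q' + 1 := ⟨q - 1, by omega⟩
    rw [Nat.add_sub_cancel]
    rw [Nat.mul_succ] at hq
    omega
  rw [e, Nat.mul_add_mod, Nat.mod_eq_of_lt (Nat.sub_lt hR one_pos)]

/-- stepping off the far face resets the own offset to `0`. [folklore] -/
theorem val_rem_add_unitVec_of_face {ν : Fin d} {x : Tor (fine (R * N) M)} (hf : R ∣ (x ν).val + 1) :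
    (rem N R M (x + unitVec (fine (R * N) M) ν) ν : ℕ) = 0 := by
  have hdvd : R ∣ fine (R * N) M ν := ⟨N * M ν, by unfold fine; ring⟩
  show ((x + unitVec (fine (R * N) M) ν) ν).val % R = 0
  have e : (x + unitVec (fine (R * N) M) ν) ν = x ν + 1 := by simp [unitVec]
  rw [e, ZMod.val_add, ZMod.val_one_eq_one_mod, Nat.add_mod_mod, Nat.mod_mod_of_dvd _ hdvd]
  exact Nat.mod_eq_zero_of_dvd hf

/-- stepping inside the cell raises the own offset by one. [folklore] -/
theorem val_rem_add_unitVec_of_not_face {ν : Fin d} {x : Tor (fine (R * N) M)} (hf : ¬ R ∣ (x ν).val + 1) :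
    (rem N R M (x + unitVec (fine (R * N) M) ν) ν : ℕ) = (rem N R M x ν : ℕ) + 1 := by
  have hR : 0 < R := Nat.pos_of_ne_zero (NeZero.ne R)
  have hdvd : R ∣ fine (R * N) M ν := ⟨N * M ν, by unfold fine; ring⟩
  have hR1 : R ≠ 1 := by
    intro h; subst h; exact hf (one_dvd _)
  have hne : (x ν).val % R ≠ R - 1 := by
    intro h
    apply hf
    rw [Nat.dvd_iff_mod_eq_zero, Nat.add_mod, h, Nat.one_mod_eq_one.mpr hR1, Nat.sub_add_cancel hR, Nat.mod_self]
  have hlt : (x ν).val % R + 1 < R := by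
    have := Nat.mod_lt (x ν).val hR; omega
  show ((x + unitVec (fine (R * N) M) ν) ν).val % R = (x ν).val % R + 1
  have e : (x + unitVec (fine (R * N) M) ν) ν = x ν + 1 := by simp [unitVec]
  rw [e, ZMod.val_add, ZMod.val_one_eq_one_mod, Nat.add_mod_mod, Nat.mod_mod_of_dvd _ hdvd, Nat.add_mod,
    Nat.one_mod_eq_one.mpr hR1, Nat.mod_eq_of_lt hlt]

/-! ## §2 The cellwise Taylor planting -/

/-- **THE CELLWISE TAYLOR PLANTING** `T = J₀ + Σ_μ diag(tw_μ)·J₀·(S_μ − 1)`: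
`(Tψ)(x) = cJ·[ψ(par x) + Σ_μ tw_μ(x)·(ψ(par x + e_μ) − ψ(par x))]` — King's piecewise-constant planting corrected by the in-cell
first-order Taylor term, so that its fine gradient inside each cell is the planted coarse gradient. [folklore] -/
def taylorJ : Matrix (Tor (fine (R * N) M)) (Tor (fine N M)) ℂ :=
  JK0 N R M + ∑ μ, Matrix.diagonal (fun x => tw N R M x μ) * JK0 N R M * (shiftS (fine N M) μ - 1)

omit [NeZero R] in
/-- `(J₀ψ)(x) = cJ·ψ(par x)`. [cite: King1986, p.664 (convention before Prop. 3.8)] [folklore] -/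
theorem JK0_mulVec (ψ : Tor (fine N M) → ℂ) (x : Tor (fine (R * N) M)) : (JK0 N R M *ᵥ ψ) x = cJ d R * ψ (par N R M x) := by
  unfold JK0 cJ
  rw [Matrix.smul_mulVec, Pi.smul_apply, smul_eq_mul, mul_assoc]
  congr 1
  simp only [Matrix.mulVec, dotProduct, Matrix.conjTranspose_apply, star_Qavg0_apply]
  simp only [Qavg0, ite_mul, zero_mul]
  rw [Finset.sum_ite_eq Finset.univ (par N R M x)]
  simp

/-- `((S_μ − 1)ψ)(X) = ψ(X + e_μ) − ψ(X)`. [folklore] -/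
theorem shiftS_sub_one_mulVec (μ : Fin d) (ψ : Tor (fine N M) → ℂ) (X : Tor (fine N M)) :
    ((shiftS (fine N M) μ - 1) *ᵥ ψ) X = ψ (X + unitVec (fine N M) μ) - ψ X := by
  have h := sdiff_mulVec (fine N M) 1 μ ψ X
  rw [one_mul] at h
  rw [← h]
  unfold Literature.MathematicalPhysics.QuantumFieldTheory.Balaban1983to89.B5Action121.sdiff
  rw [one_smul]

/-- **the planting formula**: `(Tψ)(x) = cJ·(ψ(par x) + Σ_μ tw_μ(x)·(ψ(par x + e_μ) − ψ(par x)))`. [folklore] -/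
theorem taylorJ_mulVec (ψ : Tor (fine N M) → ℂ) (x : Tor (fine (R * N) M)) :
    (taylorJ N R M *ᵥ ψ) x
      = cJ d R * (ψ (par N R M x) + ∑ μ, tw N R M x μ * (ψ (par N R M x + unitVec (fine N M) μ) - ψ (par N R M x))) := by
  unfold taylorJ
  rw [Matrix.add_mulVec, Pi.add_apply, JK0_mulVec, Matrix.sum_mulVec, Finset.sum_apply, mul_add, Finset.mul_sum]
  congr 1
  refine Finset.sum_congr rfl fun μ _ => ?_
  rw [← Matrix.mulVec_mulVec, ← Matrix.mulVec_mulVec, Matrix.mulVec_diagonal, JK0_mulVec, shiftS_sub_one_mulVec]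
  ring

/-- the Taylor correction: `(Tψ − J₀ψ)(x) = cJ·Σ_μ tw_μ(x)·(ψ(par x + e_μ) − ψ(par x))`. [folklore] -/
theorem taylorJ_sub_JK0_mulVec (ψ : Tor (fine N M) → ℂ) (x : Tor (fine (R * N) M)) :
    ((taylorJ N R M - JK0 N R M) *ᵥ ψ) x = cJ d R * ∑ μ, tw N R M x μ * (ψ (par N R M x + unitVec (fine N M) μ) - ψ (par N R M x)) := by
  rw [Matrix.sub_mulVec, Pi.sub_apply, taylorJ_mulVec, JK0_mulVec]
  ring

/-- a sum over the fine torus, tiled by cells (real-valued). [folklore] -/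
theorem sum_fine_eq_sum_tile_real (g : Tor (fine (R * N) M) → ℝ) :
    ∑ x, g x = ∑ y : Tor (fine N M), ∑ j : Fin d → Fin R, g (cpt N R M y + off N R M j) := by
  rw [← Fintype.sum_equiv (tileEquiv N R M) (fun p => g (tileEquiv N R M p)) g (fun _ => rfl), Fintype.sum_prod_type]
  rfl

omit [NeZero N] [NeZero R] hM in
/-- Cauchy–Schwarz with unit weights: `‖Σ_μ a_μ·b_μ‖² ≤ d·Σ_μ ‖b_μ‖²` when `‖a_μ‖ ≤ 1`. [folklore] -/
theorem norm_sum_mul_sq_le (s : Finset (Fin d)) (a b : Fin d → ℂ) (ha : ∀ μ, ‖a μ‖ ≤ 1) :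
    ‖∑ μ ∈ s, a μ * b μ‖ ^ 2 ≤ s.card * ∑ μ ∈ s, ‖b μ‖ ^ 2 := by
  have h1 : ‖∑ μ ∈ s, a μ * b μ‖ ≤ ∑ μ ∈ s, ‖b μ‖ := by
    refine (norm_sum_le _ _).trans (Finset.sum_le_sum fun μ _ => ?_)
    rw [norm_mul]
    calc ‖a μ‖ * ‖b μ‖ ≤ 1 * ‖b μ‖ := mul_le_mul_of_nonneg_right (ha μ) (norm_nonneg _)
      _ = ‖b μ‖ := one_mul _
  calc ‖∑ μ ∈ s, a μ * b μ‖ ^ 2 ≤ (∑ μ ∈ s, ‖b μ‖) ^ 2 := pow_le_pow_left₀ (norm_nonneg _) h1 2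
    _ ≤ s.card * ∑ μ ∈ s, ‖b μ‖ ^ 2 := sq_sum_le_card_mul_sum_sq

/-- **THE TAYLOR CORRECTION COSTS ONE COARSE GRADIENT**: `‖c‖²·nsq (Tψ − J₀ψ) ≤ d·nsq (∂_c ψ)`. [folklore] -/
theorem norm_sq_mul_nsq_taylorJ_sub_JK0_le (c : ℂ) (ψ : Tor (fine N M) → ℂ) :
    ‖c‖ ^ 2 * nsq ((taylorJ N R M - JK0 N R M) *ᵥ ψ) ≤ d * nsq (GradOp (fine N M) c *ᵥ ψ) := by
  have hRd : ‖cJ d R‖ ^ 2 * (R : ℝ) ^ d = 1 := norm_cJ_sq_mul (d := d) R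
  -- pointwise: `‖c‖²‖(Tψ − J₀ψ)(x)‖² ≤ ‖cJ‖²·d·Σ_μ ‖(∂_cψ)(par x, μ)‖²`
  have hpt : ∀ x, ‖c‖ ^ 2 * ‖((taylorJ N R M - JK0 N R M) *ᵥ ψ) x‖ ^ 2
      ≤ ‖cJ d R‖ ^ 2 * (d * ∑ μ, ‖(GradOp (fine N M) c *ᵥ ψ) (par N R M x, μ)‖ ^ 2) := by
    intro x
    rw [taylorJ_sub_JK0_mulVec, ← mul_pow, ← norm_mul, mul_left_comm, Finset.mul_sum, norm_mul, mul_pow]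
    refine mul_le_mul_of_nonneg_left ?_ (sq_nonneg _)
    have e : ∀ μ, c * (tw N R M x μ * (ψ (par N R M x + unitVec (fine N M) μ) - ψ (par N R M x)))
        = tw N R M x μ * (GradOp (fine N M) c *ᵥ ψ) (par N R M x, μ) := fun μ => by
      rw [GradOp_mulVec, sdiff_mulVec]; ring
    simp_rw [e]
    have h := norm_sum_mul_sq_le Finset.univ (fun μ => tw N R M x μ) (fun μ => (GradOp (fine N M) c *ᵥ ψ) (par N R M x, μ))
      (norm_tw_le_one N R M x)
    rwa [Finset.card_univ, Fintype.card_fin] at h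
  -- sum over the cells
  calc ‖c‖ ^ 2 * nsq ((taylorJ N R M - JK0 N R M) *ᵥ ψ)
      = ∑ x, ‖c‖ ^ 2 * ‖((taylorJ N R M - JK0 N R M) *ᵥ ψ) x‖ ^ 2 := by unfold nsq; rw [Finset.mul_sum]
    _ ≤ ∑ x, ‖cJ d R‖ ^ 2 * (d * ∑ μ, ‖(GradOp (fine N M) c *ᵥ ψ) (par N R M x, μ)‖ ^ 2) := Finset.sum_le_sum fun x _ => hpt x
    _ = ∑ y : Tor (fine N M), ∑ _j : Fin d → Fin R, ‖cJ d R‖ ^ 2 * (d * ∑ μ, ‖(GradOp (fine N M) c *ᵥ ψ) (y, μ)‖ ^ 2) := by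
        rw [sum_fine_eq_sum_tile_real N R M]
        refine Finset.sum_congr rfl fun y _ => Finset.sum_congr rfl fun j _ => ?_
        rw [par_cpt_add_off]
    _ = ∑ y : Tor (fine N M), d * ∑ μ, ‖(GradOp (fine N M) c *ᵥ ψ) (y, μ)‖ ^ 2 := by
        refine Finset.sum_congr rfl fun y _ => ?_
        rw [Finset.sum_const, Finset.card_univ, Fintype.card_fun, Fintype.card_fin, Fintype.card_fin, nsmul_eq_mul, Nat.cast_pow,
          ← mul_assoc, mul_comm ((R : ℝ) ^ d), hRd, one_mul]
    _ = d * nsq (GradOp (fine N M) c *ᵥ ψ) := by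
        unfold nsq
        rw [Finset.mul_sum, Fintype.sum_prod_type]
        refine Finset.sum_congr rfl fun y _ => ?_
        rw [Finset.mul_sum]

/-! ## §3 The gradient identity: planted coarse gradient inside the cells, mixed second differences on the faces -/

/-- the mixed second difference `Δ²_{νμ}ψ(X) = ψ(X+e_ν+e_μ) − ψ(X+e_ν) − ψ(X+e_μ) + ψ(X)`. [folklore] -/
def mixedDiff (ψ : Tor (fine N M) → ℂ) (X : Tor (fine N M)) (ν μ : Fin d) : ℂ :=
  ψ (X + unitVec (fine N M) ν + unitVec (fine N M) μ) - ψ (X + unitVec (fine N M) ν) - ψ (X + unitVec (fine N M) μ) + ψ X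

/-- THE FACE-CROSSING DEFECT of the planted gradient: `0` on intra-cell bonds, `cJ·R·c·Σ_{μ≠ν} tw_μ(x)·Δ²_{νμ}ψ(par x)` on the bonds
leaving the far `ν`-face of a cell. [folklore] -/
def gdef (c : ℂ) (ψ : Tor (fine N M) → ℂ) (x : Tor (fine (R * N) M)) (ν : Fin d) : ℂ :=
  if R ∣ (x ν).val + 1 then cJ d R * ((R : ℂ) * c) * ∑ μ ∈ univ.erase ν, tw N R M x μ * mixedDiff N M ψ (par N R M x) ν μ else 0

/-- `(∂_c∂_c)_{νμ}ψ(X) = c²·Δ²_{νμ}ψ(X)`. [folklore] -/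
theorem sdiff_sdiff_mulVec (c : ℂ) (ψ : Tor (fine N M) → ℂ) (X : Tor (fine N M)) (ν μ : Fin d) :
    (sdiff (fine N M) c ν *ᵥ (sdiff (fine N M) c μ *ᵥ ψ)) X = c ^ 2 * mixedDiff N M ψ X ν μ := by
  rw [sdiff_mulVec, sdiff_mulVec, sdiff_mulVec, mixedDiff]
  ring

/-- **THE GRADIENT IDENTITY**: `(∂′_{R·c}(Tψ))(x,ν) − (JK(∂_cψ))(x,ν) = gdef c ψ x ν` — the fine gradient of the Taylor planting IS
King's planted coarse gradient on every intra-cell bond; on the face-crossing bonds it differs by in-cell-weighted MIXED second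
differences. [folklore] -/
theorem GradOp_taylorJ_sub_JK_GradOp_apply (c : ℂ) (ψ : Tor (fine N M) → ℂ) (x : Tor (fine (R * N) M)) (ν : Fin d) :
    (GradOp (fine (R * N) M) ((R : ℂ) * c) *ᵥ (taylorJ N R M *ᵥ ψ)) (x, ν) - (JK N R M *ᵥ (GradOp (fine N M) c *ᵥ ψ)) (x, ν)
      = gdef N R M c ψ x ν := by
  have hR : (R : ℂ) ≠ 0 := by exact_mod_cast NeZero.ne R
  have hRp : 0 < R := Nat.pos_of_ne_zero (NeZero.ne R)
  have hRd : ((R : ℂ) ^ d) ≠ 0 := pow_ne_zero _ hR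
  have htμ : ∀ μ ∈ univ.erase ν, tw N R M (x + unitVec (fine (R * N) M) ν) μ = tw N R M x μ := fun μ hμ => by
    unfold tw; rw [rem_add_unitVec_of_ne N R M (Finset.ne_of_mem_erase hμ)]
  rw [GradOp_mulVec, sdiff_mulVec, JK_mulVec]
  simp only [parT]
  rw [GradOp_mulVec, sdiff_mulVec, taylorJ_mulVec, taylorJ_mulVec]
  rw [← Finset.add_sum_erase _ _ (Finset.mem_univ ν), ← Finset.add_sum_erase _ _ (Finset.mem_univ ν)]
  have hS : ∑ μ ∈ univ.erase ν, tw N R M (x + unitVec (fine (R * N) M) ν) μ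
        * (ψ (par N R M (x + unitVec (fine (R * N) M) ν) + unitVec (fine N M) μ) - ψ (par N R M (x + unitVec (fine (R * N) M) ν)))
      = ∑ μ ∈ univ.erase ν, tw N R M x μ
        * (ψ (par N R M (x + unitVec (fine (R * N) M) ν) + unitVec (fine N M) μ) - ψ (par N R M (x + unitVec (fine (R * N) M) ν))) :=
    Finset.sum_congr rfl fun μ hμ => by rw [htμ μ hμ]
  rw [hS]
  unfold gdef
  by_cases hf : R ∣ (x ν).val + 1
  · -- face-crossing bond
    have hX' : par N R M (x + unitVec (fine (R * N) M) ν) = par N R M x + unitVec (fine N M) ν := by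
      rw [par_add_unitVec, if_pos hf]
    have htν : tw N R M (x + unitVec (fine (R * N) M) ν) ν = 0 := by
      unfold tw; rw [val_rem_add_unitVec_of_face N R M hf]; simp
    have htν0 : tw N R M x ν = ((R : ℂ) - 1) / R := by
      unfold tw; rw [val_rem_of_face N R M hf, Nat.cast_pred hRp]
    rw [if_pos hf, hX', htν, htν0]
    have hΔ : ∑ μ ∈ univ.erase ν, tw N R M x μ * mixedDiff N M ψ (par N R M x) ν μ
        = (∑ μ ∈ univ.erase ν, tw N R M x μ
            * (ψ (par N R M x + unitVec (fine N M) ν + unitVec (fine N M) μ) - ψ (par N R M x + unitVec (fine N M) ν)))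
          - ∑ μ ∈ univ.erase ν, tw N R M x μ * (ψ (par N R M x + unitVec (fine N M) μ) - ψ (par N R M x)) := by
      rw [← Finset.sum_sub_distrib]
      exact Finset.sum_congr rfl fun μ _ => by rw [mixedDiff]; ring
    rw [hΔ]
    unfold cJ
    field_simp
    ring
  · -- intra-cell bond
    have hX : par N R M (x + unitVec (fine (R * N) M) ν) = par N R M x := by rw [par_add_unitVec, if_neg hf]
    have htν : tw N R M (x + unitVec (fine (R * N) M) ν) ν = tw N R M x ν + 1 / R := by
      unfold tw; rw [val_rem_add_unitVec_of_not_face N R M hf]; push_cast; ring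
    rw [if_neg hf, hX, htν]
    unfold cJ
    field_simp
    ring

/-- the norm form of the identity: `∂′_{R·c}(Tψ) − JK(∂_cψ) = gdef c ψ` as fields. [folklore] -/
theorem GradOp_taylorJ_sub_JK_GradOp (c : ℂ) (ψ : Tor (fine N M) → ℂ) :
    GradOp (fine (R * N) M) ((R : ℂ) * c) *ᵥ (taylorJ N R M *ᵥ ψ) - JK N R M *ᵥ (GradOp (fine N M) c *ᵥ ψ)
      = fun i => gdef N R M c ψ i.1 i.2 := by
  funext i
  obtain ⟨x, ν⟩ := i
  rw [Pi.sub_apply]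
  exact GradOp_taylorJ_sub_JK_GradOp_apply N R M c ψ x ν

/-- pointwise bound: `‖c‖²·‖gdef c ψ x ν‖² ≤ ‖cJ‖²·R²·d·Σ_{μ≠ν} ‖(∂_ν∂_μψ)(par x)‖²`. [folklore] -/
theorem norm_sq_mul_norm_gdef_sq_le (c : ℂ) (ψ : Tor (fine N M) → ℂ) (x : Tor (fine (R * N) M)) (ν : Fin d) :
    ‖c‖ ^ 2 * ‖gdef N R M c ψ x ν‖ ^ 2
      ≤ ‖cJ d R‖ ^ 2 * (R : ℝ) ^ 2 * (d * ∑ μ ∈ univ.erase ν, ‖(sdiff (fine N M) c ν *ᵥ (sdiff (fine N M) c μ *ᵥ ψ)) (par N R M x)‖ ^ 2) := by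
  unfold gdef
  by_cases hf : R ∣ (x ν).val + 1
  · rw [if_pos hf]
    simp_rw [sdiff_sdiff_mulVec]
    have h := norm_sum_mul_sq_le (univ.erase ν) (fun μ => tw N R M x μ) (fun μ => c ^ 2 * mixedDiff N M ψ (par N R M x) ν μ)
      (norm_tw_le_one N R M x)
    have hcard : ((univ.erase ν).card : ℝ) ≤ d := by
      rw [Finset.card_erase_of_mem (Finset.mem_univ ν), Finset.card_univ, Fintype.card_fin]
      exact_mod_cast Nat.sub_le d 1
    have hsum : ∑ μ ∈ univ.erase ν, tw N R M x μ * (c ^ 2 * mixedDiff N M ψ (par N R M x) ν μ)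
        = c ^ 2 * ∑ μ ∈ univ.erase ν, tw N R M x μ * mixedDiff N M ψ (par N R M x) ν μ := by
      rw [Finset.mul_sum]; exact Finset.sum_congr rfl fun μ _ => by ring
    rw [hsum] at h
    have hS0 : 0 ≤ ∑ μ ∈ univ.erase ν, ‖c ^ 2 * mixedDiff N M ψ (par N R M x) ν μ‖ ^ 2 := Finset.sum_nonneg fun _ _ => by positivity
    calc ‖c‖ ^ 2 * ‖cJ d R * ((R : ℂ) * c) * ∑ μ ∈ univ.erase ν, tw N R M x μ * mixedDiff N M ψ (par N R M x) ν μ‖ ^ 2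
        = ‖cJ d R‖ ^ 2 * (R : ℝ) ^ 2 * ‖c ^ 2 * ∑ μ ∈ univ.erase ν, tw N R M x μ * mixedDiff N M ψ (par N R M x) ν μ‖ ^ 2 := by
          rw [norm_mul, norm_mul, norm_mul, norm_mul, Complex.norm_natCast, norm_pow]; ring
      _ ≤ ‖cJ d R‖ ^ 2 * (R : ℝ) ^ 2 * ((univ.erase ν).card * ∑ μ ∈ univ.erase ν, ‖c ^ 2 * mixedDiff N M ψ (par N R M x) ν μ‖ ^ 2) :=
          mul_le_mul_of_nonneg_left h (by positivity)
      _ ≤ ‖cJ d R‖ ^ 2 * (R : ℝ) ^ 2 * (d * ∑ μ ∈ univ.erase ν, ‖c ^ 2 * mixedDiff N M ψ (par N R M x) ν μ‖ ^ 2) :=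
          mul_le_mul_of_nonneg_left (mul_le_mul_of_nonneg_right hcard hS0) (by positivity)
  · rw [if_neg hf, norm_zero]
    have : 0 ≤ ‖cJ d R‖ ^ 2 * (R : ℝ) ^ 2 * (d * ∑ μ ∈ univ.erase ν, ‖(sdiff (fine N M) c ν *ᵥ (sdiff (fine N M) c μ *ᵥ ψ)) (par N R M x)‖ ^ 2) :=
      by positivity
    simpa using this

/-- **THE PLANTED-GRADIENT DEFECT IN NORM**: `‖c‖²·nsq (∂′_{R·c}(Tψ) − JK(∂_cψ)) ≤ d·R²·Hmixed c ψ` — the face-crossing defect of the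
cellwise Taylor planting is controlled by the MIXED discrete Hessian of the coarse field on the torus (for the zero extension of a box
solution, `Hmixed ≤ Σ_Ω|Δψ|²` by gan24's corner-free H² identity `DirichletBoxRegularity.sum_normSq_LapS_eq`). [folklore] -/
theorem norm_sq_mul_nsq_GradOp_taylorJ_sub_le (c : ℂ) (ψ : Tor (fine N M) → ℂ) :
    ‖c‖ ^ 2 * nsq (GradOp (fine (R * N) M) ((R : ℂ) * c) *ᵥ (taylorJ N R M *ᵥ ψ) - JK N R M *ᵥ (GradOp (fine N M) c *ᵥ ψ))
      ≤ d * (R : ℝ) ^ 2 * Hmixed c ψ := by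
  have hRd : ‖cJ d R‖ ^ 2 * (R : ℝ) ^ d = 1 := norm_cJ_sq_mul (d := d) R
  rw [GradOp_taylorJ_sub_JK_GradOp]
  unfold nsq
  rw [Finset.mul_sum, Fintype.sum_prod_type]
  calc ∑ x, ∑ ν, ‖c‖ ^ 2 * ‖gdef N R M c ψ (x, ν).1 (x, ν).2‖ ^ 2
      ≤ ∑ x, ∑ ν, ‖cJ d R‖ ^ 2 * (R : ℝ) ^ 2
          * (d * ∑ μ ∈ univ.erase ν, ‖(sdiff (fine N M) c ν *ᵥ (sdiff (fine N M) c μ *ᵥ ψ)) (par N R M x)‖ ^ 2) :=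
        Finset.sum_le_sum fun x _ => Finset.sum_le_sum fun ν _ => norm_sq_mul_norm_gdef_sq_le N R M c ψ x ν
    _ = ∑ y : Tor (fine N M), ∑ _j : Fin d → Fin R, ∑ ν, ‖cJ d R‖ ^ 2 * (R : ℝ) ^ 2
          * (d * ∑ μ ∈ univ.erase ν, ‖(sdiff (fine N M) c ν *ᵥ (sdiff (fine N M) c μ *ᵥ ψ)) y‖ ^ 2) := by
        rw [sum_fine_eq_sum_tile_real N R M]
        refine Finset.sum_congr rfl fun y _ => Finset.sum_congr rfl fun j _ => ?_
        rw [par_cpt_add_off]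
    _ = ∑ y : Tor (fine N M), ∑ ν, (R : ℝ) ^ 2
          * (d * ∑ μ ∈ univ.erase ν, ‖(sdiff (fine N M) c ν *ᵥ (sdiff (fine N M) c μ *ᵥ ψ)) y‖ ^ 2) := by
        refine Finset.sum_congr rfl fun y _ => ?_
        rw [Finset.sum_const, Finset.card_univ, Fintype.card_fun, Fintype.card_fin, Fintype.card_fin, nsmul_eq_mul, Nat.cast_pow,
          Finset.mul_sum]
        refine Finset.sum_congr rfl fun ν _ => ?_
        have key : ∀ S : ℝ, (R : ℝ) ^ d * (‖cJ d R‖ ^ 2 * (R : ℝ) ^ 2 * (d * S)) = (R : ℝ) ^ 2 * (d * S) := fun S => by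
          calc (R : ℝ) ^ d * (‖cJ d R‖ ^ 2 * (R : ℝ) ^ 2 * (d * S)) = (‖cJ d R‖ ^ 2 * (R : ℝ) ^ d) * ((R : ℝ) ^ 2 * (d * S)) := by ring
            _ = (R : ℝ) ^ 2 * (d * S) := by rw [hRd, one_mul]
        exact key _
    _ = d * (R : ℝ) ^ 2 * Hmixed c ψ := by
        unfold Hmixed nsq
        rw [Finset.mul_sum, Finset.sum_comm]
        refine Finset.sum_congr rfl fun ν _ => ?_
        simp_rw [Finset.mul_sum]
        rw [Finset.sum_comm]
        exact Finset.sum_congr rfl fun μ _ => Finset.sum_congr rfl fun y _ => by ring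

end Summit.QuantumFields.BalabanUV.T4Continuum.CellTaylorPlanting

end
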